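import Summits.BirchSwinnertonDyer.Rank1Residual.Additive.SpecialJDeuring
import Mathlib.Algebra.Polynomial.Expand
import HarnessLib

/-!
# Deuring in characteristic `3`: `j = 0 ⟺ supersingular` over EVERY finite field `𝔽_{3^f}`

HONEST FRAMING (cell `b2b-bsdres`, run/shared/lean/b2b/bsd-rank1-residual/, verbatim in every
file): the goal of the cell is to DELETE the COMBINATION-SHAPED residual classes of the
Birch–Swinnerton-Dyer formula for ALL analytic-rank `≤ 1` elliptic curves over `ℚ` — "full BSD
formula for every rank `≤ 1` curve in class `C`" assembled STRICTLY from published theorems — so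
that the rank-`≤ 1` remainder becomes exactly the CONSTRUCTION-SHAPED classes, which are TYPED
(missing-input `Prop`s), NOT attempted. This is not "finishing BSD". Sub-cell `additive-p2`
(X3♯(G-ord)/X4♯(G-ord): additive `p`, potentially good ORDINARY), generation 10: research route;
no claim beyond the stated classes; theorems only, no definition, no named fact.

WHAT THIS FILE DOES. The finite-field input of the sub-cell's dictionary at `p = 3` (gen 9 NEXT
(a): "needs a characteristic-3 Deuring lemma; the tree's Euler-criterion point count
`HasseElementary` is for SHORT normal form only"). Over a field of characteristic `3` one cannot
complete the cube, so we count points on `y² = x³ + a₂x² + a₄x + a₆` (Mathlib `IsCharNeTwoNF`):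

* `sum_eval_eq_neg_coeff` — for `P ∈ F[X]` with `deg P < 2(q − 1)`, `Σ_{x ∈ F} P(x) = −[x^{q−1}]P`
  (power sums over `𝔽_q`; gen 3's `SpecialJ.sum_pow_eq_ite_eq`);
* `coeff_pow_three`, **`coeff_cubic_pow_eq`** — in characteristic `3`,
  `[x^{3^f − 1}] (x³ + a₂x² + a₄x + a₆)^{(3^f−1)/2} = a₂^{(3^f−1)/2}`: the HASSE INVARIANT of
  `y² = x³ + a₂x² + a₄x + a₆` relative to `𝔽_{3^f}` is the norm-power of `A = a₂`
  (induction on `f`: `Q³ = Frob(Q)(x³)`, and `x^{3^{f+1}−1} = x^{3(3^f−1)} · x²` picks `a₂`);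
* `natCard_point_eq_of_isCharNeTwoNF`, `intCast_trace_eq_neg_sum_pow_of_isCharNeTwoNF` — the
  point count `#E(F) = 1 + Σ_x #{y : y² = f(x)}` and Euler's criterion
  `q + 1 − #E(F) = −Σ_x f(x)^{(q−1)/2}` in `F` for `IsCharNeTwoNF` equations (odd `q`);
* **`ringChar_dvd_trace_iff_j_eq_zero_of_three`** — for an elliptic curve `E` over a finite field
  `F` of characteristic `3`: `3 ∣ #F + 1 − #E(F)` (SUPERSINGULAR) **iff** `j(E) = 0`
  (`c₄ = b₂² = a₂²` in characteristic `3`); `Nat.card` form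
  `dvd_trace_iff_j_eq_zero_of_ringChar_eq_three`;
* number-field forms at a place `w ∋ 3` of good reduction: `reductionAt_j_ne_zero_of_not_lt`
  (`¬ w(j) < 1 ⇒ j̃ ≠ 0`, any residue characteristic) and
  **`hasUnitRootAt_iff_not_valuation_j_lt_one_of_three_mem`**: `E` is ORDINARY at `w` iff
  `j(E)` is a `w`-adic UNIT (`¬ w(j) < 1`).

In print: M. Deuring, Abh. Math. Sem. Hamburg 14 (1941) §§4–5 (the Hasse invariant; in
characteristic `3` the only supersingular invariant is `j = 0 = 1728`); J. H. Silverman, *AEC*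
Thm. V.4.1(a),(c) and Ex. V.4.4/5.7 (`#E(𝔽_q) ≡ 1 − A_q`, `A` the coefficient of `x^{q−1}` in
`f^{(q−1)/2}`); L. C. Washington, *Elliptic Curves* §4.6 (Prop. 4.31/Thm. 4.34 with
`q = 3^f`); D. Husemöller, *Elliptic Curves* Ch. 13 §3 (Def. 3.1, Prop. 3.6: in characteristic 3
the Hasse invariant of `y² = x³ + a₂x² + a₆` is `a₂`). The proofs here are self-contained
(power sums + Frobenius on `F[X]`).
-/

noncomputable section

open scoped Classical

open Finset Polynomial WeierstrassCurve

namespace Summit.BirchSwinnertonDyer.Rank1Residual.Additive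

namespace DeuringThree

/-! ### Power sums of a polynomial over a finite field -/

section PowerSum

variable {F : Type*} [Field F] [Fintype F]

/-- **`Σ_{x ∈ 𝔽_q} P(x) = −[x^{q−1}] P` for `deg P < 2(q − 1)`**: the power sums `Σ_x xⁱ` vanish
for `0 < i < 2(q−1)`, `i ≠ q − 1` (`SpecialJ.sum_pow_eq_ite_eq`), `Σ_x x⁰ = q = 0` in `F`, and
`Σ_x x^{q−1} = −1`. Ireland–Rosen Ch. 18 §3; Washington Lemma 4.35. -/
theorem sum_eval_eq_neg_coeff (P : F[X]) (hP : P.natDegree < 2 * (Fintype.card F - 1)) :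
    ∑ x : F, P.eval x = -P.coeff (Fintype.card F - 1) := by
  have hq : 1 < Fintype.card F := Fintype.one_lt_card
  simp_rw [eval_eq_sum_range' hP]
  rw [sum_comm]
  have hinner : ∀ i ∈ range (2 * (Fintype.card F - 1)),
      ∑ x : F, P.coeff i * x ^ i =
        if i = Fintype.card F - 1 then -P.coeff (Fintype.card F - 1) else 0 := by
    intro i hi
    rw [mem_range] at hi
    rw [← mul_sum]
    by_cases hi0 : i = 0
    · subst hi0
      rw [if_neg (by omega)]
      simp only [pow_zero, sum_const, card_univ, nsmul_eq_mul, mul_one]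
      rw [FiniteField.cast_card_eq_zero, mul_zero]
    · rw [SpecialJ.sum_pow_eq_ite_eq i hi0 hi]
      by_cases hiq : i = Fintype.card F - 1
      · subst hiq; rw [if_pos rfl, if_pos rfl, mul_neg, mul_one]
      · rw [if_neg hiq, if_neg hiq, mul_zero]
  rw [sum_congr rfl hinner, sum_ite_eq' (range (2 * (Fintype.card F - 1))) (Fintype.card F - 1),
    if_pos (mem_range.mpr (by omega))]

end PowerSum

/-! ### The Hasse invariant of `y² = x³ + a₂x² + a₄x + a₆` in characteristic `3` -/

section HasseInvariant

variable {R : Type*} [CommRing R] [CharP R 3]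

/-- In characteristic `3`, `Q³ = Σ_k c_k³ x^{3k}` (Frobenius on `R[X]`, Mathlib
`map_frobenius_expand`): the coefficient of `xⁱ` in `Q³` is `c_{i/3}³` if `3 ∣ i` and `0`
otherwise. [folklore] -/
theorem coeff_pow_three (Q : R[X]) (i : ℕ) :
    (Q ^ 3).coeff i = if 3 ∣ i then Q.coeff (i / 3) ^ 3 else 0 := by
  rw [← map_frobenius_expand (p := 3) Q, coeff_map, coeff_expand (by norm_num : 0 < 3)]
  split_ifs
  · rw [frobenius_def]
  · rw [map_zero]

/-- **The Hasse invariant in characteristic `3`**: for every `f ≥ 0`,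
`[x^{3^f − 1}] (x³ + a₂x² + a₄x + a₆)^{(3^f − 1)/2} = a₂^{(3^f − 1)/2}` in any commutative ring of
characteristic `3`. Induction on `f`: with `m = (3^f − 1)/2` and `Q = P^m`,
`P^{(3^{f+1}−1)/2} = Q³ · P`, `Q³ = Σ c_k³ x^{3k}`, and among `x³, a₂x², a₄x, a₆` only `a₂x²` has
degree `≡ 3^{f+1} − 1 ≡ 2 (mod 3)`, contributing `a₂ · c_{3^f−1}³`. (Deuring 1941; Silverman *AEC*
V.4.1(a): the Hasse invariant relative to `𝔽_q` is the norm-power `A^{1+3+⋯+3^{f−1}}` of the one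
relative to `𝔽_3`, and for `q = 3` it is the coefficient `a₂` of `x²` in `f(x)¹`; Husemöller
Ch. 13 Prop. 3.6.) -/
theorem coeff_cubic_pow_eq (a₂ a₄ a₆ : R) (f : ℕ) :
    ((X ^ 3 + C a₂ * X ^ 2 + C a₄ * X + C a₆ : R[X]) ^ ((3 ^ f - 1) / 2)).coeff (3 ^ f - 1) =
      a₂ ^ ((3 ^ f - 1) / 2) := by
  induction f with
  | zero => simp
  | succ f ih =>
    set P : R[X] := X ^ 3 + C a₂ * X ^ 2 + C a₄ * X + C a₆ with hP
    have hodd : 3 ^ f % 2 = 1 := Nat.odd_iff.mp (Odd.pow (by decide : Odd 3))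
    obtain ⟨m, hm⟩ : ∃ m, 3 ^ f = 2 * m + 1 := ⟨3 ^ f / 2, by omega⟩
    have hf : 3 ^ f - 1 = 2 * m := by omega
    have hmf : (3 ^ f - 1) / 2 = m := by omega
    have hN : 3 ^ (f + 1) - 1 = 3 * (2 * m) + 2 := by rw [pow_succ]; omega
    have hexp : (3 ^ (f + 1) - 1) / 2 = m * 3 + 1 := by rw [pow_succ]; omega
    rw [hmf, hf] at ih
    rw [hexp, hN, pow_succ, pow_mul]
    set Q : R[X] := P ^ m with hQ
    have hsplit : Q ^ 3 * P =
        Q ^ 3 * X ^ 3 + C a₂ * (Q ^ 3 * X ^ 2) + C a₄ * (Q ^ 3 * X ^ 1) + C a₆ * Q ^ 3 := by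
      rw [hP]; ring
    rw [hsplit, coeff_add, coeff_add, coeff_add, coeff_C_mul, coeff_C_mul, coeff_C_mul,
      coeff_mul_X_pow', coeff_mul_X_pow', coeff_mul_X_pow', coeff_pow_three Q (3 * (2 * m) + 2)]
    -- the `x³` term
    have h3 : (if 3 ≤ 3 * (2 * m) + 2 then (Q ^ 3).coeff (3 * (2 * m) + 2 - 3) else 0) = 0 := by
      split_ifs with h
      · rw [coeff_pow_three, if_neg (by omega)]
      · rfl
    -- the `a₂ x²` term
    have h2 : (if 2 ≤ 3 * (2 * m) + 2 then (Q ^ 3).coeff (3 * (2 * m) + 2 - 2) else 0) =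
        (a₂ ^ m) ^ 3 := by
      rw [if_pos (by omega), coeff_pow_three, if_pos ⟨2 * m, by omega⟩,
        show (3 * (2 * m) + 2 - 2) / 3 = 2 * m by omega, hQ, ih]
    -- the `a₄ x` term
    have h1 : (if 1 ≤ 3 * (2 * m) + 2 then (Q ^ 3).coeff (3 * (2 * m) + 2 - 1) else 0) = 0 := by
      rw [if_pos (by omega), coeff_pow_three, if_neg (by omega)]
    rw [h3, h2, h1, if_neg (by omega)]
    ring

end HasseInvariant

/-! ### `y² = x³ + a₂x² + a₄x + a₆` over a finite field of odd characteristic: point count, Euler's criterion -/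

section CharNeTwoNF

variable {F : Type*} [Field F] [Fintype F] (E : WeierstrassCurve F) [E.IsCharNeTwoNF]
  [E.IsElliptic]

/-- `#E(F) = 1 + Σ_x #{y : y² = x³ + a₂x² + a₄x + a₆}` for an elliptic curve in `a₁ = a₃ = 0`
form (the point at infinity plus the affine solutions, all nonsingular; the tree's
`HasseElementary.natCard_point_eq` is the short-normal-form case). [folklore] -/
theorem natCard_point_eq_of_isCharNeTwoNF :
    Nat.card E.toAffine.Point =
      1 + ∑ x : F, (univ.filter fun y : F ↦ y ^ 2 = x ^ 3 + E.a₂ * x ^ 2 + E.a₄ * x + E.a₆).card := by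
  have e : E.toAffine.Point ≃ Option {xy : F × F // E.toAffine.Nonsingular xy.1 xy.2} :=
    WeierstrassCurve.Affine.nonsingularPointEquiv E.toAffine
  rw [Nat.card_congr e, Nat.card_eq_fintype_card, Fintype.card_option, add_comm]
  congr 1
  have e1 : {xy : F × F // E.toAffine.Nonsingular xy.1 xy.2} ≃
      {xy : F × F // xy.2 ^ 2 = xy.1 ^ 3 + E.a₂ * xy.1 ^ 2 + E.a₄ * xy.1 + E.a₆} := by
    refine Equiv.subtypeEquivRight fun xy ↦ ?_
    rw [← WeierstrassCurve.Affine.equation_iff_nonsingular, WeierstrassCurve.Affine.equation_iff,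
      E.a₁_of_isCharNeTwoNF, E.a₃_of_isCharNeTwoNF]
    constructor <;> intro h <;> linear_combination h
  rw [Fintype.card_congr e1,
    Fintype.card_congr (Equiv.subtypeProdEquivSigmaSubtype fun (x y : F) ↦
      y ^ 2 = x ^ 3 + E.a₂ * x ^ 2 + E.a₄ * x + E.a₆),
    Fintype.card_sigma]
  refine sum_congr rfl fun x _ ↦ ?_
  rw [Fintype.card_subtype]

/-- **The trace as a character sum** for `y² = f(x) = x³ + a₂x² + a₄x + a₆` over a finite field of
odd characteristic: `q + 1 − #E(F) = −Σ_x χ(f(x))` (`#{y : y² = c} = χ(c) + 1`, Mathlib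
`quadraticChar_card_sqrts`). Washington Thm. 4.14; Ireland–Rosen Ch. 18 §4. -/
theorem trace_eq_neg_sum_quadraticChar_of_isCharNeTwoNF (hF : ringChar F ≠ 2) :
    ((Fintype.card F : ℤ) + 1 - Nat.card E.toAffine.Point) =
      -∑ x : F, (quadraticChar F (x ^ 3 + E.a₂ * x ^ 2 + E.a₄ * x + E.a₆) : ℤ) := by
  have hcnt : ∀ x : F,
      ((univ.filter fun y : F ↦ y ^ 2 = x ^ 3 + E.a₂ * x ^ 2 + E.a₄ * x + E.a₆).card : ℤ) =
        quadraticChar F (x ^ 3 + E.a₂ * x ^ 2 + E.a₄ * x + E.a₆) + 1 := by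
    intro x
    rw [← quadraticChar_card_sqrts hF, Set.toFinset_setOf]
  rw [natCard_point_eq_of_isCharNeTwoNF E]
  push_cast
  simp_rw [hcnt]
  rw [sum_add_distrib, sum_const, card_univ, nsmul_eq_mul, mul_one]
  ring

/-- **Euler's criterion form of the trace**: in `F`,
`q + 1 − #E(F) = −Σ_{x ∈ F} (x³ + a₂x² + a₄x + a₆)^{⌊q/2⌋}` (`χ(t) = t^{(q−1)/2}`). Silverman *AEC*
V.4.1(a) (proof); Washington Thm. 4.34. -/
theorem intCast_trace_eq_neg_sum_pow_of_isCharNeTwoNF (hF : ringChar F ≠ 2) :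
    (((Fintype.card F : ℤ) + 1 - Nat.card E.toAffine.Point : ℤ) : F) =
      -∑ x : F, (x ^ 3 + E.a₂ * x ^ 2 + E.a₄ * x + E.a₆) ^ (Fintype.card F / 2) := by
  rw [trace_eq_neg_sum_quadraticChar_of_isCharNeTwoNF E hF]
  push_cast
  simp_rw [quadraticChar_eq_pow_of_char_ne_two' hF]

/-! ### Characteristic `3`: supersingular iff `a₂ = 0` iff `j = 0` -/

/-- In characteristic `3`, for `E : y² = x³ + a₂x² + a₄x + a₆` elliptic over a finite field `F`
(`#F = 3^f`): `3 ∣ #F + 1 − #E(F)` iff `a₂ = 0` — the trace is `≡ A_q = a₂^{(q−1)/2}`, the Hasse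
invariant (`coeff_cubic_pow_eq`, `sum_eval_eq_neg_coeff`). Silverman *AEC* V.4.1(a);
Husemöller Ch. 13 Prop. 3.6. -/
theorem three_dvd_trace_iff_a₂_eq_zero (hchar : ringChar F = 3) :
    (3 : ℤ) ∣ (Fintype.card F : ℤ) + 1 - Nat.card E.toAffine.Point ↔ E.a₂ = 0 := by
  haveI : CharP F 3 := ringChar.of_eq hchar
  have hF : ringChar F ≠ 2 := by rw [hchar]; decide
  obtain ⟨n, -, hn⟩ := FiniteField.card F 3
  have hq : Fintype.card F = 2 * (Fintype.card F / 2) + 1 :=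
    Literature.NumberTheory.EllipticCurves.HasseElementary.card_eq_two_mul_add_one hF
  have hq1 : 1 < Fintype.card F := Fintype.one_lt_card
  have key : ((((Fintype.card F : ℤ) + 1 - Nat.card E.toAffine.Point : ℤ) : F) = 0) ↔
      (3 : ℤ) ∣ (Fintype.card F : ℤ) + 1 - Nat.card E.toAffine.Point := by
    simpa using CharP.intCast_eq_zero_iff F 3
      ((Fintype.card F : ℤ) + 1 - Nat.card E.toAffine.Point)
  rw [← key, intCast_trace_eq_neg_sum_pow_of_isCharNeTwoNF E hF, neg_eq_zero]
  -- the character sum is the evaluation sum of `P^{(q−1)/2}`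
  set P : F[X] := X ^ 3 + C E.a₂ * X ^ 2 + C E.a₄ * X + C E.a₆ with hP
  have heval : ∀ x : F, (x ^ 3 + E.a₂ * x ^ 2 + E.a₄ * x + E.a₆) ^ (Fintype.card F / 2) =
      (P ^ (Fintype.card F / 2)).eval x := by
    intro x
    simp [hP, eval_pow]
  simp_rw [heval]
  have hP3 : P.natDegree ≤ 3 := by
    simpa [hP] using Polynomial.natDegree_cubic_le (a := (1 : F)) (b := E.a₂) (c := E.a₄) (d := E.a₆)
  have hdeg : (P ^ (Fintype.card F / 2)).natDegree < 2 * (Fintype.card F - 1) := by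
    refine lt_of_le_of_lt natDegree_pow_le ?_
    have := Nat.mul_le_mul_left (Fintype.card F / 2) hP3
    omega
  rw [sum_eval_eq_neg_coeff _ hdeg, neg_eq_zero, hn,
    show 3 ^ (n : ℕ) / 2 = (3 ^ (n : ℕ) - 1) / 2 by omega, hP, coeff_cubic_pow_eq]
  refine ⟨fun h ↦ ?_, fun h ↦ by rw [h, zero_pow (by rw [← hn] at *; omega)]⟩
  exact pow_eq_zero_iff (by rw [← hn] at *; omega) |>.mp h

/-- In characteristic `3` and `a₁ = a₃ = 0` form, `c₄ = b₂² − 24 b₄ = a₂²`, so `j = 0 ⟺ a₂ = 0`.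
Silverman *AEC* III.1 and A.1.1 (`b₂ = a₁² + 4a₂`). -/
theorem j_eq_zero_iff_a₂_eq_zero_of_charP_three {K : Type*} [Field K] [CharP K 3]
    (V : WeierstrassCurve K) [V.IsCharNeTwoNF] [V.IsElliptic] : V.j = 0 ↔ V.a₂ = 0 := by
  have h3 : (3 : K) = 0 := by simpa using CharP.cast_eq_zero K 3
  have hc4 : V.c₄ = V.a₂ ^ 2 := by
    rw [V.c₄_of_isCharNeTwoNF]
    linear_combination (5 * V.a₂ ^ 2 - 16 * V.a₄) * h3
  rw [j_eq_zero_iff, hc4]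
  exact pow_eq_zero_iff two_ne_zero

/-- **Deuring in characteristic `3`, normal form**: for `E : y² = x³ + a₂x² + a₄x + a₆` elliptic
over a finite field of characteristic `3`, `3 ∣ #F + 1 − #E(F) ⟺ j(E) = 0`. -/
theorem three_dvd_trace_iff_j_eq_zero_of_isCharNeTwoNF (hchar : ringChar F = 3) :
    (3 : ℤ) ∣ (Fintype.card F : ℤ) + 1 - Nat.card E.toAffine.Point ↔ E.j = 0 := by
  haveI : CharP F 3 := ringChar.of_eq hchar
  rw [three_dvd_trace_iff_a₂_eq_zero E hchar, j_eq_zero_iff_a₂_eq_zero_of_charP_three]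

end CharNeTwoNF

/-! ### Deuring in characteristic `3` for an arbitrary Weierstrass equation -/

section General

variable {F : Type*} [Field F] [Fintype F] (E : WeierstrassCurve F) [E.IsElliptic]

/-- **Deuring's criterion in characteristic `3`, every finite field**: for an elliptic curve `E`
over a finite field `F` with `ringChar F = 3` (`#F = 3^f`, any `f`), `E` is SUPERSINGULAR
(`3 ∣ #F + 1 − #E(F)`) iff `j(E) = 0` (`= 1728`). Reduction to `a₁ = a₃ = 0` form by Mathlib's
`toCharNeTwoNF` (`2 ∈ Fˣ`; same `j`, same point count by the tree's `VariableChange.pointEquiv`).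
Deuring 1941; Silverman *AEC* V.4.1, Ex. 5.7; Washington §4.6; Husemöller Ch. 13 §3. -/
theorem ringChar_dvd_trace_iff_j_eq_zero_of_three (hchar : ringChar F = 3) :
    (3 : ℤ) ∣ (Fintype.card F : ℤ) + 1 - Nat.card E.toAffine.Point ↔ E.j = 0 := by
  have h2 : (2 : F) ≠ 0 := Ring.two_ne_zero (by rw [hchar]; decide)
  haveI : Invertible (2 : F) := invertibleOfNonzero h2
  rw [Nat.card_congr (VariableChange.pointEquiv E E.toCharNeTwoNF).toEquiv,
    three_dvd_trace_iff_j_eq_zero_of_isCharNeTwoNF (E.toCharNeTwoNF • E) hchar, variableChange_j]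

/-- `Nat.card` form (residue fields of number fields are `Finite`): in characteristic `3`,
`3 ∣ #k + 1 − #E(k) ⟺ j(E) = 0` — the NEGATION of the tree's `HasUnitRootAt` integer test. -/
theorem dvd_trace_iff_j_eq_zero_of_ringChar_eq_three {k : Type*} [Field k] [Finite k]
    (E : WeierstrassCurve k) [E.IsElliptic] (hchar : ringChar k = 3) :
    (3 : ℤ) ∣ (Nat.card k : ℤ) + 1 - Nat.card E.toAffine.Point ↔ E.j = 0 := by
  haveI := Fintype.ofFinite k
  rw [Nat.card_eq_fintype_card]
  exact ringChar_dvd_trace_iff_j_eq_zero_of_three E hchar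

end General

end DeuringThree

/-! ### At a place above `3` of a number field: ORDINARY iff `j` is a unit -/

section Residue

open scoped NumberField

open IsDedekindDomain IsDedekindDomain.HeightOneSpectrum NumberField IsLocalRing
  Literature.NumberTheory.EllipticCurves

variable {K : Type*} [Field K] [NumberField K] (V : WeierstrassCurve K) [V.IsElliptic]
  (w : HeightOneSpectrum (𝓞 K))

/-- **`j` a `w`-unit at a place of good reduction ⟹ `j̃ ≠ 0`** (any residue characteristic): if
`¬ w(j) < 1` then the reduced curve `Ẽ_w` has nonzero `j`-invariant. Contrapositive of the route
`j̃ = 0 ⇒ c₄(Ẽ_w) = 0 ⇒ c₄(X) ∈ 𝔪 ⇒ w(j) = w(c₄(X)³) < 1` on the local minimal model `X`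
(`localMinimalModel_c₄_pow_three_and_c₆_sq`, `Δ_X ∈ 𝒪ˣ`); converse companion of gen 3's
`reductionAt_j_eq_zero`. Silverman *AEC* VII.2, VII.5.1. -/
theorem reductionAt_j_ne_zero_of_not_lt (hgood : V.HasGoodReductionAt w)
    [(V.reductionAt w).IsElliptic] (hj : ¬ w.valuation K V.j < 1) : (V.reductionAt w).j ≠ 0 := by
  intro hj0
  apply hj
  have hc4 : (V.reductionAt w).c₄ = 0 := (j_eq_zero_iff _).mp hj0
  set O := w.adicCompletionIntegers K with hO
  set X := V.localMinimalModel w with hX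
  have hg : X.HasGoodReduction O := hgood
  haveI := hg.toIsMinimal
  set val := (IsDiscreteValuationRing.maximalIdeal O).valuation (w.adicCompletion K) with hval
  have hΔ1 : val X.Δ = 1 := hg.goodReduction
  have hmem : (X.integralModel O).c₄ ∈ IsLocalRing.maximalIdeal O := by
    have h : ((X.integralModel O).map (IsLocalRing.residue O)).c₄ = 0 := hc4
    rwa [map_c₄, IsLocalRing.residue_eq_zero_iff] at h
  have hc4v : val X.c₄ < 1 := by
    rw [← integralModel_c₄_eq O X]
    exact (valuation_lt_one_iff_mem (IsDiscreteValuationRing.maximalIdeal O) _).mpr hmem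
  have h := congrArg val (localMinimalModel_c₄_pow_three_and_c₆_sq V w).1
  rw [map_pow, map_mul, hΔ1, mul_one] at h
  have hjv : val (algebraMap K (w.adicCompletion K) V.j) < 1 := by
    rw [← h]
    exact pow_lt_one₀ zero_le hc4v three_ne_zero
  exact (valuation_maximalIdeal_lt_one_iff w V.j).mp hjv

/-- **Good reduction with `w(j) < 1` above `3` is SUPERSINGULAR** — at ANY place `w ∋ 3` of ANY
number field (residue field `𝔽_{3^f}`): the unit-root condition `HasUnitRootAt` fails
(`DeuringThree.dvd_trace_iff_j_eq_zero_of_ringChar_eq_three` on the reduced curve, gen 3's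
`reductionAt_j_eq_zero`). Deuring 1941; Silverman *AEC* V.4.1, Ex. 5.7. -/
theorem not_hasUnitRootAt_of_valuation_j_lt_one_three (h3w : ((3 : ℕ) : 𝓞 K) ∈ w.asIdeal)
    (hgood : V.HasGoodReductionAt w) (hj : w.valuation K V.j < 1) : ¬ V.HasUnitRootAt w := by
  haveI : (V.reductionAt w).IsElliptic := isElliptic_reductionAt hgood
  have hchar := ringChar_residueField_eq w Nat.prime_three h3w
  rw [WeierstrassCurve.hasUnitRootAt_iff, hchar, not_not]
  simp only [Nat.cast_ofNat]
  exact (DeuringThree.dvd_trace_iff_j_eq_zero_of_ringChar_eq_three (V.reductionAt w) hchar).mpr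
    (reductionAt_j_eq_zero V w hgood hj)

/-- **Good reduction with `j` a unit above `3` is ORDINARY** — at any place `w ∋ 3` of any number
field: if `¬ w(j) < 1` then `HasUnitRootAt` holds (`j̃ ≠ 0`, `reductionAt_j_ne_zero_of_not_lt`,
and Deuring in characteristic `3`). Deuring 1941; Silverman *AEC* V.4.1, Ex. 5.7. -/
theorem hasUnitRootAt_of_not_valuation_j_lt_one_three (h3w : ((3 : ℕ) : 𝓞 K) ∈ w.asIdeal)
    (hgood : V.HasGoodReductionAt w) (hj : ¬ w.valuation K V.j < 1) : V.HasUnitRootAt w := by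
  haveI : (V.reductionAt w).IsElliptic := isElliptic_reductionAt hgood
  have hchar := ringChar_residueField_eq w Nat.prime_three h3w
  rw [WeierstrassCurve.hasUnitRootAt_iff, hchar]
  simp only [Nat.cast_ofNat]
  exact fun hdvd ↦ reductionAt_j_ne_zero_of_not_lt V w hgood hj
    ((DeuringThree.dvd_trace_iff_j_eq_zero_of_ringChar_eq_three (V.reductionAt w) hchar).mp hdvd)

/-- **ORDINARY ⟺ `j` IS A UNIT, above `3`**: at a place `w ∋ 3` of good reduction of any number
field, `E` satisfies the unit-root condition iff `¬ w(j(E)) < 1`. In characteristic `3` the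
supersingular `j`-invariant is `0` alone (Deuring 1941; Silverman *AEC* V.4.1(c), Ex. 5.7;
Washington §4.6). -/
theorem hasUnitRootAt_iff_not_valuation_j_lt_one_of_three_mem (h3w : ((3 : ℕ) : 𝓞 K) ∈ w.asIdeal)
    (hgood : V.HasGoodReductionAt w) : V.HasUnitRootAt w ↔ ¬ w.valuation K V.j < 1 :=
  ⟨fun h hj ↦ not_hasUnitRootAt_of_valuation_j_lt_one_three V w h3w hgood hj h,
    hasUnitRootAt_of_not_valuation_j_lt_one_three V w h3w hgood⟩

end Residue

end Summit.BirchSwinnertonDyer.Rank1Residual.Additive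

end
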